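import Summits.AnomalousDissipation.AnomalousDissipation.Theorems.SawtoothPulseCascadeLipAgmonPhase
import Literature.Analysis.FluidPDE.SawtoothCascade

/-!
# Phase bookkeeping of the line `lip-agmon`, part 3: from slot bounds to a phase envelope
(route `AnomalousDissipation/SawtoothPulseCascade`, crux ApproxSol58 = stmt-AnomalousDissipation-19688;
lead g4, module F)

Pure real-variable bookkeeping. Six nonnegative size functions `zf, w0, w1, v00, v01, v11` of time
(the `L²` sizes of the response vorticity and of its first and second derivatives) vanish at `t = 0`
and satisfy, on every half-slot of the sawtooth cascade lying before a horizon `T = tStart JA`, the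
phase-form slot bounds produced by `natural_le_phaseForm` (hypotheses `hH`, `hV`). Then, clamping the
phase sequences at the horizon and running `phase_bounds`, the level-0 size and the level-2 size are
bounded on phase `j ∩ [0, T]` by `Bz ν (j+1) (4μ)^{j+1}` and `B₂ ν (j+1) R_V^{j+1}`,
`R_V = 4(16μ + (1+γ)²) + (1+γ+γ²)²`, with `Bz, B₂` depending only on `γ, K, μ` and the constants.
-/

set_option linter.dupNamespace false

noncomputable section

namespace Summit.AnomalousDissipation.AnomalousDissipation.Theorems.SawtoothPulseCascade.LipAgmon

open Set
open Literature.Analysis.FluidPDE.SawtoothCascade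

/-- Monotonicity of the envelope shape `B (ν (j+1)) R^{j+1}` in `j` for `R ≥ 1`. [folklore] -/
theorem envelope_mono' {B ν R : ℝ} (hB : 0 ≤ B) (hν : 0 ≤ ν) (hR : 1 ≤ R) {j' j : ℕ} (h : j' ≤ j) :
    B * (ν * ((j' : ℝ) + 1)) * R ^ (j' + 1) ≤ B * (ν * ((j : ℝ) + 1)) * R ^ (j + 1) := by
  have h1 : ((j' : ℝ) + 1) ≤ (j : ℝ) + 1 := by exact_mod_cast Nat.succ_le_succ h
  have h2 : R ^ (j' + 1) ≤ R ^ (j + 1) := pow_le_pow_right₀ hR (by omega)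
  have h3 : 0 ≤ R ^ (j' + 1) := pow_nonneg (zero_le_one.trans hR) _
  calc B * (ν * ((j' : ℝ) + 1)) * R ^ (j' + 1) ≤ B * (ν * ((j : ℝ) + 1)) * R ^ (j' + 1) := by gcongr
    _ ≤ B * (ν * ((j : ℝ) + 1)) * R ^ (j + 1) := by gcongr

set_option maxHeartbeats 800000 in
/-- From phase-form slot bounds to the phase envelope.  Given nonnegative size functions
`zf, w0, w1, v00, v01, v11` vanishing at `0` which obey the phase-form `H`-slot and `V`-slot bounds
(`hH`, `hV`, the output shape of `natural_le_phaseForm`) on every half-slot before the horizon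
`T = tStart JA`, the level-0 size `zf` and the level-2 size `v00 + v01 + v11` are bounded on phase `j`
(intersected with `[0, T]`) by `Bz ν (j+1) (4μ)^{j+1}` and `B₂ ν (j+1) R_V^{j+1}`, where the constants
`Bz, B₂ ≥ 0` come from `phase_bounds` and do not depend on `ν`, `T` or the size functions. [folklore] -/
theorem slot_envelope {γ K μ C₂ C₃ C₄ C₅ : ℝ} (hγ : 0 ≤ γ) (hK : 0 ≤ K) (hμ : 4 ≤ μ)
    (hC₂ : 0 ≤ C₂) (hC₃ : 0 ≤ C₃) (hC₄ : 0 ≤ C₄) (hC₅ : 0 ≤ C₅) :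
    ∃ Bz B₂ : ℝ, 0 ≤ Bz ∧ 0 ≤ B₂ ∧
    ∀ (ν : ℝ), 0 < ν → ν ≤ 1 → ∀ (T : ℝ) (JA : ℕ), T = CascadeParams.tStart JA →
    ∀ (zf w0 w1 v00 v01 v11 : ℝ → ℝ),
      (∀ t, 0 ≤ zf t) → (∀ t, 0 ≤ w0 t) → (∀ t, 0 ≤ w1 t) → (∀ t, 0 ≤ v00 t) → (∀ t, 0 ≤ v01 t) →
      (∀ t, 0 ≤ v11 t) → zf 0 = 0 → w0 0 = 0 → w1 0 = 0 → v00 0 = 0 → v01 0 = 0 → v11 0 = 0 →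
      -- the `H`-slot bounds in phase form
      (∀ j : ℕ, CascadeParams.tStart j + CascadeParams.tHalf j ≤ T →
        ∀ t ∈ Icc (CascadeParams.tStart j) (CascadeParams.tStart j + CascadeParams.tHalf j), ∀ (Zp Sp : ℝ),
          Zp = zf (CascadeParams.tStart j) +
            γ * (4 * 4 ^ j) * (C₂ * (K * ν * ((j : ℝ) + 1) * μ ^ (j + 1)) + C₃ * ν * (4 * 4 ^ j)) →
          Sp = (1 + γ) * (w0 (CascadeParams.tStart j) + w1 (CascadeParams.tStart j)) +
            γ * (1 + γ) * C₂ * (4 * 4 ^ j) * Zp + γ * (C₃ * (4 * 4 ^ j) ^ 2 * (K * ν * ((j : ℝ) + 1) * μ ^ (j + 1)) +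
              C₂ * (4 * 4 ^ j) * Zp + C₄ * ν * (4 * 4 ^ j) ^ 3) →
          zf t ≤ Zp ∧ w0 t + w1 t ≤ Sp ∧
          v00 t + v01 t + v11 t ≤ (1 + γ + γ ^ 2) *
              ((v00 (CascadeParams.tStart j) + v01 (CascadeParams.tStart j) + v11 (CascadeParams.tStart j)) +
                γ * C₂ * (4 * 4 ^ j) * Sp + γ * (C₃ * (4 * 4 ^ j) ^ 2 * Zp + C₂ * (4 * 4 ^ j) * Sp) +
                γ * (C₄ * (4 * 4 ^ j) ^ 3 * (K * ν * ((j : ℝ) + 1) * μ ^ (j + 1)) +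
                  2 * C₃ * (4 * 4 ^ j) ^ 2 * Zp + C₂ * (4 * 4 ^ j) * Sp + C₅ * ν * (4 * 4 ^ j) ^ 4)) +
            γ * C₂ * (4 * 4 ^ j) * ((w0 (CascadeParams.tStart j) + w1 (CascadeParams.tStart j)) +
              γ * C₂ * (4 * 4 ^ j) * Zp)) →
      -- the `V`-slot bounds in phase form
      (∀ j : ℕ, CascadeParams.tStart (j + 1) ≤ T →
        ∀ t ∈ Icc (CascadeParams.tStart j + CascadeParams.tHalf j) (CascadeParams.tStart (j + 1)),
          ∀ (Zp Sp : ℝ),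
          Zp = zf (CascadeParams.tStart j + CascadeParams.tHalf j) +
            γ * (4 * 4 ^ j) * (C₂ * (K * ν * ((j : ℝ) + 1) * μ ^ (j + 1)) + C₃ * ν * (4 * 4 ^ j)) →
          Sp = (1 + γ) * (w0 (CascadeParams.tStart j + CascadeParams.tHalf j) +
              w1 (CascadeParams.tStart j + CascadeParams.tHalf j)) +
            γ * (1 + γ) * C₂ * (4 * 4 ^ j) * Zp + γ * (C₃ * (4 * 4 ^ j) ^ 2 * (K * ν * ((j : ℝ) + 1) * μ ^ (j + 1)) +
              C₂ * (4 * 4 ^ j) * Zp + C₄ * ν * (4 * 4 ^ j) ^ 3) →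
          zf t ≤ Zp ∧ w0 t + w1 t ≤ Sp ∧
          v00 t + v01 t + v11 t ≤ (1 + γ + γ ^ 2) *
              ((v00 (CascadeParams.tStart j + CascadeParams.tHalf j) +
                  v01 (CascadeParams.tStart j + CascadeParams.tHalf j) +
                  v11 (CascadeParams.tStart j + CascadeParams.tHalf j)) +
                γ * C₂ * (4 * 4 ^ j) * Sp + γ * (C₃ * (4 * 4 ^ j) ^ 2 * Zp + C₂ * (4 * 4 ^ j) * Sp) +
                γ * (C₄ * (4 * 4 ^ j) ^ 3 * (K * ν * ((j : ℝ) + 1) * μ ^ (j + 1)) +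
                  2 * C₃ * (4 * 4 ^ j) ^ 2 * Zp + C₂ * (4 * 4 ^ j) * Sp + C₅ * ν * (4 * 4 ^ j) ^ 4)) +
            γ * C₂ * (4 * 4 ^ j) * ((w0 (CascadeParams.tStart j + CascadeParams.tHalf j) +
                w1 (CascadeParams.tStart j + CascadeParams.tHalf j)) + γ * C₂ * (4 * 4 ^ j) * Zp)) →
      ∀ j : ℕ, ∀ t ∈ Icc 0 T, t ∈ Icc (CascadeParams.tStart j) (CascadeParams.tStart (j + 1)) →
        zf t ≤ Bz * (ν * ((j : ℝ) + 1)) * (4 * μ) ^ (j + 1) ∧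
        v00 t + v01 t + v11 t ≤
          B₂ * (ν * ((j : ℝ) + 1)) * (4 * (4 ^ 2 * μ + (1 + γ) ^ 2) + (1 + γ + γ ^ 2) ^ 2) ^ (j + 1) := by
  obtain ⟨Bz, B₁, B₂, hBz0, -, hB₂0, hPB⟩ := phase_bounds (γ := γ) (K := K) (μ := μ) (σ := 4) (s₀ := 4)
    (c₂ := C₂) (c₃ := C₃) (c₄ := C₄) (c₅ := C₅) hγ hK (by norm_num) hμ (by nlinarith) (by norm_num)
    hC₂ hC₃ hC₄ hC₅
  refine ⟨Bz, B₂, hBz0, hB₂0, ?_⟩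
  intro ν hν0 hν1 T JA hTJ zf w0 w1 v00 v01 v11 hz0' hw0' hw1' hv00' hv01' hv11' hz00 hw00 hw10 hv000 hv010
    hv110 hH hV
  have hμ0 : 0 ≤ μ := le_trans (by norm_num) hμ
  have hT0 : 0 ≤ T := by rw [hTJ]; exact CascadeParams.tStart_nonneg _
  have hs0 : ∀ j : ℕ, (0 : ℝ) ≤ 4 * 4 ^ j := fun j => by positivity
  have he0 : ∀ j : ℕ, 0 ≤ (K * ν * ((j : ℝ) + 1) * μ ^ (j + 1)) := fun j => by positivity
  have hmid : ∀ j : ℕ, CascadeParams.tStart j + CascadeParams.tHalf j ≤ CascadeParams.tStart (j + 1) :=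
    fun j => by rw [CascadeParams.tStart_succ]; linarith only [CascadeParams.tHalf_pos j]
  -- ### the phase sequences (clamped at the horizon)
  obtain ⟨zs, hzs⟩ : ∃ g : ℕ → ℝ, ∀ j, g j = zf (min (CascadeParams.tStart j) T) := ⟨_, fun _ => rfl⟩
  obtain ⟨S1s, hS1s⟩ : ∃ g : ℕ → ℝ, ∀ j, g j = w0 (min (CascadeParams.tStart j) T) +
      w1 (min (CascadeParams.tStart j) T) := ⟨_, fun _ => rfl⟩
  obtain ⟨S2s, hS2s⟩ : ∃ g : ℕ → ℝ, ∀ j, g j = v00 (min (CascadeParams.tStart j) T) +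
      v01 (min (CascadeParams.tStart j) T) + v11 (min (CascadeParams.tStart j) T) := ⟨_, fun _ => rfl⟩
  obtain ⟨zm, hzm⟩ : ∃ g : ℕ → ℝ, ∀ j, g j = zf (min (CascadeParams.tStart j + CascadeParams.tHalf j) T) :=
    ⟨_, fun _ => rfl⟩
  obtain ⟨S1m, hS1m⟩ : ∃ g : ℕ → ℝ, ∀ j, g j = w0 (min (CascadeParams.tStart j + CascadeParams.tHalf j) T) +
      w1 (min (CascadeParams.tStart j + CascadeParams.tHalf j) T) := ⟨_, fun _ => rfl⟩
  obtain ⟨S2m, hS2m⟩ : ∃ g : ℕ → ℝ, ∀ j, g j = v00 (min (CascadeParams.tStart j + CascadeParams.tHalf j) T) +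
      v01 (min (CascadeParams.tStart j + CascadeParams.tHalf j) T) +
      v11 (min (CascadeParams.tStart j + CascadeParams.tHalf j) T) := ⟨_, fun _ => rfl⟩
  -- clamping
  have hclampA : ∀ j : ℕ, j + 1 ≤ JA →
      min (CascadeParams.tStart j) T = CascadeParams.tStart j ∧
      min (CascadeParams.tStart j + CascadeParams.tHalf j) T = CascadeParams.tStart j + CascadeParams.tHalf j ∧
      min (CascadeParams.tStart (j + 1)) T = CascadeParams.tStart (j + 1) ∧
      CascadeParams.tStart j + CascadeParams.tHalf j ≤ T ∧ CascadeParams.tStart (j + 1) ≤ T := by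
    intro j hj
    have h3 : CascadeParams.tStart (j + 1) ≤ T := by
      rw [hTJ]; exact CascadeParams.tStart_strictMono.monotone hj
    have h2 : CascadeParams.tStart j + CascadeParams.tHalf j ≤ T := (hmid j).trans h3
    have h1 : CascadeParams.tStart j ≤ T := le_trans (le_add_of_nonneg_right (CascadeParams.tHalf_pos j).le) h2
    exact ⟨min_eq_left h1, min_eq_left h2, min_eq_left h3, h2, h3⟩
  have hclampB : ∀ j : ℕ, ¬ j + 1 ≤ JA →
      min (CascadeParams.tStart j) T = T ∧ min (CascadeParams.tStart j + CascadeParams.tHalf j) T = T ∧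
      min (CascadeParams.tStart (j + 1)) T = T := by
    intro j hj
    have hJ : JA ≤ j := by omega
    have h1 : T ≤ CascadeParams.tStart j := by rw [hTJ]; exact CascadeParams.tStart_strictMono.monotone hJ
    have h2 : T ≤ CascadeParams.tStart j + CascadeParams.tHalf j :=
      h1.trans (le_add_of_nonneg_right (CascadeParams.tHalf_pos j).le)
    have h3 : T ≤ CascadeParams.tStart (j + 1) := by
      rw [hTJ]; exact CascadeParams.tStart_strictMono.monotone (by omega)
    exact ⟨min_eq_right h1, min_eq_right h2, min_eq_right h3⟩
  have hmin0 : min (CascadeParams.tStart 0) T = 0 := by rw [CascadeParams.tStart_zero]; exact min_eq_left hT0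
  have hzs0 : zs 0 = 0 := by rw [hzs, hmin0, hz00]
  have hS1s0 : S1s 0 = 0 := by rw [hS1s, hmin0, hw00, hw10, add_zero]
  have hS2s0 : S2s 0 = 0 := by rw [hS2s, hmin0, hv000, hv010, hv110]; ring
  have hnn : ∀ j, 0 ≤ zs j ∧ 0 ≤ S1s j ∧ 0 ≤ S2s j ∧ 0 ≤ zm j ∧ 0 ≤ S1m j ∧ 0 ≤ S2m j := by
    intro j
    rw [hzs, hS1s, hS2s, hzm, hS1m, hS2m]
    exact ⟨hz0' _, add_nonneg (hw0' _) (hw1' _), add_nonneg (add_nonneg (hv00' _) (hv01' _)) (hv11' _),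
      hz0' _, add_nonneg (hw0' _) (hw1' _), add_nonneg (add_nonneg (hv00' _) (hv01' _)) (hv11' _)⟩
  have hprod0 : ∀ j : ℕ, 0 ≤ γ * (4 * 4 ^ j) * (C₂ * (K * ν * ((j : ℝ) + 1) * μ ^ (j + 1)) +
      C₃ * ν * (4 * 4 ^ j)) := fun j => by positivity
  -- ### the slot relations fed to `phase_bounds`
  have hst0 : ∀ j : ℕ, zm j ≤ zs j + γ * (4 * 4 ^ j) * (C₂ * (K * ν * ((j : ℝ) + 1) * μ ^ (j + 1)) +
      C₃ * ν * (4 * 4 ^ j)) ∧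
      zs (j + 1) ≤ zm j + γ * (4 * 4 ^ j) * (C₂ * (K * ν * ((j : ℝ) + 1) * μ ^ (j + 1)) +
        C₃ * ν * (4 * 4 ^ j)) := by
    intro j
    by_cases hj : j + 1 ≤ JA
    · obtain ⟨e1, e2, e3, h2, h3⟩ := hclampA j hj
      rw [hzm, hzs, hzs, e1, e2, e3]
      exact ⟨(hH j h2 _ (right_mem_Icc.2 (le_add_of_nonneg_right (CascadeParams.tHalf_pos j).le)) _ _
          rfl rfl).1, (hV j h3 _ (right_mem_Icc.2 (hmid j)) _ _ rfl rfl).1⟩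
    · obtain ⟨e1, e2, e3⟩ := hclampB j hj
      rw [hzm, hzs, hzs, e1, e2, e3]
      exact ⟨le_add_of_nonneg_right (hprod0 j), le_add_of_nonneg_right (hprod0 j)⟩
  have hst1 : ∀ j : ℕ,
      S1m j ≤ (1 + γ) * S1s j + γ * (1 + γ) * C₂ * (4 * 4 ^ j) * (zs j + γ * (4 * 4 ^ j) *
          (C₂ * (K * ν * ((j : ℝ) + 1) * μ ^ (j + 1)) + C₃ * ν * (4 * 4 ^ j))) +
        γ * (C₃ * (4 * 4 ^ j) ^ 2 * (K * ν * ((j : ℝ) + 1) * μ ^ (j + 1)) + C₂ * (4 * 4 ^ j) *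
          (zs j + γ * (4 * 4 ^ j) * (C₂ * (K * ν * ((j : ℝ) + 1) * μ ^ (j + 1)) + C₃ * ν * (4 * 4 ^ j))) +
          C₄ * ν * (4 * 4 ^ j) ^ 3) ∧
      S1s (j + 1) ≤ (1 + γ) * S1m j + γ * (1 + γ) * C₂ * (4 * 4 ^ j) * (zm j + γ * (4 * 4 ^ j) *
          (C₂ * (K * ν * ((j : ℝ) + 1) * μ ^ (j + 1)) + C₃ * ν * (4 * 4 ^ j))) +
        γ * (C₃ * (4 * 4 ^ j) ^ 2 * (K * ν * ((j : ℝ) + 1) * μ ^ (j + 1)) + C₂ * (4 * 4 ^ j) *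
          (zm j + γ * (4 * 4 ^ j) * (C₂ * (K * ν * ((j : ℝ) + 1) * μ ^ (j + 1)) + C₃ * ν * (4 * 4 ^ j))) +
          C₄ * ν * (4 * 4 ^ j) ^ 3) := by
    intro j
    by_cases hj : j + 1 ≤ JA
    · obtain ⟨e1, e2, e3, h2, h3⟩ := hclampA j hj
      rw [hS1m, hS1s, hS1s, hzm, hzs, e1, e2, e3]
      exact ⟨(hH j h2 _ (right_mem_Icc.2 (le_add_of_nonneg_right (CascadeParams.tHalf_pos j).le)) _ _
          rfl rfl).2.1, (hV j h3 _ (right_mem_Icc.2 (hmid j)) _ _ rfl rfl).2.1⟩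
    · obtain ⟨e1, e2, e3⟩ := hclampB j hj
      rw [hS1m, hS1s, hS1s, hzm, hzs, e1, e2, e3]
      have hS0 : 0 ≤ w0 T + w1 T := add_nonneg (hw0' _) (hw1' _)
      have hz0T : 0 ≤ zf T := hz0' _
      have hx : 0 ≤ γ * (1 + γ) * C₂ * (4 * 4 ^ j) * (zf T + γ * (4 * 4 ^ j) *
            (C₂ * (K * ν * ((j : ℝ) + 1) * μ ^ (j + 1)) + C₃ * ν * (4 * 4 ^ j))) +
          γ * (C₃ * (4 * 4 ^ j) ^ 2 * (K * ν * ((j : ℝ) + 1) * μ ^ (j + 1)) + C₂ * (4 * 4 ^ j) *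
            (zf T + γ * (4 * 4 ^ j) * (C₂ * (K * ν * ((j : ℝ) + 1) * μ ^ (j + 1)) + C₃ * ν * (4 * 4 ^ j))) +
            C₄ * ν * (4 * 4 ^ j) ^ 3) := by
        positivity
      have hy : w0 T + w1 T ≤ (1 + γ) * (w0 T + w1 T) := by nlinarith
      exact ⟨by linarith, by linarith⟩
  have hst2 : ∀ j : ℕ, ∀ (Zp Sp Zp' Sp' : ℝ),
      Zp = zs j + γ * (4 * 4 ^ j) * (C₂ * (K * ν * ((j : ℝ) + 1) * μ ^ (j + 1)) + C₃ * ν * (4 * 4 ^ j)) →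
      Sp = (1 + γ) * S1s j + γ * (1 + γ) * C₂ * (4 * 4 ^ j) * Zp + γ * (C₃ * (4 * 4 ^ j) ^ 2 *
        (K * ν * ((j : ℝ) + 1) * μ ^ (j + 1)) + C₂ * (4 * 4 ^ j) * Zp + C₄ * ν * (4 * 4 ^ j) ^ 3) →
      Zp' = zm j + γ * (4 * 4 ^ j) * (C₂ * (K * ν * ((j : ℝ) + 1) * μ ^ (j + 1)) + C₃ * ν * (4 * 4 ^ j)) →
      Sp' = (1 + γ) * S1m j + γ * (1 + γ) * C₂ * (4 * 4 ^ j) * Zp' + γ * (C₃ * (4 * 4 ^ j) ^ 2 *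
        (K * ν * ((j : ℝ) + 1) * μ ^ (j + 1)) + C₂ * (4 * 4 ^ j) * Zp' + C₄ * ν * (4 * 4 ^ j) ^ 3) →
      S2m j ≤ (1 + γ + γ ^ 2) * (S2s j + γ * C₂ * (4 * 4 ^ j) * Sp + γ * (C₃ * (4 * 4 ^ j) ^ 2 * Zp +
          C₂ * (4 * 4 ^ j) * Sp) + γ * (C₄ * (4 * 4 ^ j) ^ 3 * (K * ν * ((j : ℝ) + 1) * μ ^ (j + 1)) +
          2 * C₃ * (4 * 4 ^ j) ^ 2 * Zp + C₂ * (4 * 4 ^ j) * Sp + C₅ * ν * (4 * 4 ^ j) ^ 4)) +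
        γ * C₂ * (4 * 4 ^ j) * (S1s j + γ * C₂ * (4 * 4 ^ j) * Zp) ∧
      S2s (j + 1) ≤ (1 + γ + γ ^ 2) * (S2m j + γ * C₂ * (4 * 4 ^ j) * Sp' + γ * (C₃ * (4 * 4 ^ j) ^ 2 * Zp' +
          C₂ * (4 * 4 ^ j) * Sp') + γ * (C₄ * (4 * 4 ^ j) ^ 3 * (K * ν * ((j : ℝ) + 1) * μ ^ (j + 1)) +
          2 * C₃ * (4 * 4 ^ j) ^ 2 * Zp' + C₂ * (4 * 4 ^ j) * Sp' + C₅ * ν * (4 * 4 ^ j) ^ 4)) +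
        γ * C₂ * (4 * 4 ^ j) * (S1m j + γ * C₂ * (4 * 4 ^ j) * Zp') := by
    intro j Zp Sp Zp' Sp' eZp eSp eZp' eSp'
    by_cases hj : j + 1 ≤ JA
    · obtain ⟨e1, e2, e3, h2, h3⟩ := hclampA j hj
      rw [hzs, e1] at eZp
      rw [hzm, e2] at eZp'
      rw [hS1s, e1] at eSp
      rw [hS1m, e2] at eSp'
      have h2H := (hH j h2 _ (right_mem_Icc.2 (le_add_of_nonneg_right (CascadeParams.tHalf_pos j).le))
        Zp Sp eZp eSp).2.2
      have h2V := (hV j h3 _ (right_mem_Icc.2 (hmid j)) Zp' Sp' eZp' eSp').2.2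
      rw [hS2m, hS2s, hS2s, hS1m, hS1s, e1, e2, e3]
      exact ⟨h2H, h2V⟩
    · obtain ⟨e1, e2, e3⟩ := hclampB j hj
      rw [hzs, e1] at eZp
      rw [hzm, e2] at eZp'
      rw [hS1s, e1] at eSp
      rw [hS1m, e2] at eSp'
      rw [hS2m, hS2s, hS2s, hS1m, hS1s, e1, e2, e3]
      have hS20 : 0 ≤ v00 T + v01 T + v11 T := add_nonneg (add_nonneg (hv00' _) (hv01' _)) (hv11' _)
      have hS10 : 0 ≤ w0 T + w1 T := add_nonneg (hw0' _) (hw1' _)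
      have hzT : 0 ≤ zf T := hz0' T
      have hZp0 : 0 ≤ Zp := by rw [eZp]; positivity
      have hZp'0 : 0 ≤ Zp' := by rw [eZp']; positivity
      have hSp0 : 0 ≤ Sp := by rw [eSp]; positivity
      have hSp'0 : 0 ≤ Sp' := by rw [eSp']; positivity
      have hT1 : 0 ≤ 1 + γ + γ ^ 2 := by positivity
      have hs0j := hs0 j
      have hej := he0 j
      constructor
      · have hx : 0 ≤ γ * C₂ * (4 * 4 ^ j) * Sp + γ * (C₃ * (4 * 4 ^ j) ^ 2 * Zp + C₂ * (4 * 4 ^ j) * Sp) +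
            γ * (C₄ * (4 * 4 ^ j) ^ 3 * (K * ν * ((j : ℝ) + 1) * μ ^ (j + 1)) + 2 * C₃ * (4 * 4 ^ j) ^ 2 * Zp +
              C₂ * (4 * 4 ^ j) * Sp + C₅ * ν * (4 * 4 ^ j) ^ 4) := by positivity
        have hy : 0 ≤ γ * C₂ * (4 * 4 ^ j) * (w0 T + w1 T + γ * C₂ * (4 * 4 ^ j) * Zp) := by positivity
        have hz : 0 ≤ (γ + γ ^ 2) * (v00 T + v01 T + v11 T) := by positivity
        have hw := mul_nonneg hT1 hx
        linarith [hw, hy, hz]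
      · have hx : 0 ≤ γ * C₂ * (4 * 4 ^ j) * Sp' + γ * (C₃ * (4 * 4 ^ j) ^ 2 * Zp' + C₂ * (4 * 4 ^ j) * Sp') +
            γ * (C₄ * (4 * 4 ^ j) ^ 3 * (K * ν * ((j : ℝ) + 1) * μ ^ (j + 1)) + 2 * C₃ * (4 * 4 ^ j) ^ 2 * Zp' +
              C₂ * (4 * 4 ^ j) * Sp' + C₅ * ν * (4 * 4 ^ j) ^ 4) := by positivity
        have hy : 0 ≤ γ * C₂ * (4 * 4 ^ j) * (w0 T + w1 T + γ * C₂ * (4 * 4 ^ j) * Zp') := by positivity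
        have hz : 0 ≤ (γ + γ ^ 2) * (v00 T + v01 T + v11 T) := by positivity
        have hw := mul_nonneg hT1 hx
        linarith [hw, hy, hz]
  have hB := hPB ν hν0 hν1 zs S1s S2s zm S1m S2m hzs0 hS1s0 hS2s0 hnn hst0 hst1 hst2
  -- ### the bounds on the phases before the horizon
  have hin : ∀ j : ℕ, j + 1 ≤ JA → ∀ t ∈ Icc (CascadeParams.tStart j) (CascadeParams.tStart (j + 1)),
      zf t ≤ Bz * (ν * ((j : ℝ) + 1)) * (4 * μ) ^ (j + 1) ∧
      v00 t + v01 t + v11 t ≤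
        B₂ * (ν * ((j : ℝ) + 1)) * (4 * (4 ^ 2 * μ + (1 + γ) ^ 2) + (1 + γ + γ ^ 2) ^ 2) ^ (j + 1) := by
    intro j hj t ht
    obtain ⟨e1, e2, -, h2, h3⟩ := hclampA j hj
    by_cases hth : t ≤ CascadeParams.tStart j + CascadeParams.tHalf j
    · obtain ⟨hZ, -, hS⟩ := hH j h2 t ⟨ht.1, hth⟩ _ _ rfl rfl
      obtain ⟨hBZ, -, hBS⟩ := (hB j).2.1 _ _ rfl rfl
      rw [hzs, e1] at hBZ
      rw [hzs, hS1s, hS2s, e1] at hBS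
      exact ⟨hZ.trans hBZ, hS.trans hBS⟩
    · obtain ⟨hZ, -, hS⟩ := hV j h3 t ⟨(not_le.1 hth).le, ht.2⟩ _ _ rfl rfl
      obtain ⟨hBZ, -, hBS⟩ := (hB j).2.2 _ _ rfl rfl
      rw [hzm, e2] at hBZ
      rw [hzm, hS1m, hS2m, e2] at hBS
      exact ⟨hZ.trans hBZ, hS.trans hBS⟩
  -- ### conclusion (at the horizon itself use the last phase before it, or `t = 0`)
  have hRZ1 : (1 : ℝ) ≤ 4 * μ := by linarith
  have hRV1 : (1 : ℝ) ≤ 4 * (4 ^ 2 * μ + (1 + γ) ^ 2) + (1 + γ + γ ^ 2) ^ 2 := by nlinarith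
  intro j t ht hph
  by_cases hj : j + 1 ≤ JA
  · exact hin j hj t hph
  · have hJ : JA ≤ j := by omega
    have htT : t = T := le_antisymm ht.2
      (le_trans (by rw [hTJ]; exact CascadeParams.tStart_strictMono.monotone hJ) hph.1)
    rw [htT]
    rcases Nat.eq_zero_or_pos JA with hJ0 | hJpos
    · have hT00 : T = 0 := by rw [hTJ, hJ0, CascadeParams.tStart_zero]
      rw [hT00, hz00, hv000, hv010, hv110, add_zero, add_zero]
      exact ⟨by positivity, by positivity⟩
    · obtain ⟨j', hj'⟩ : ∃ j', JA = j' + 1 := Nat.exists_eq_succ_of_ne_zero hJpos.ne'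
      have hj'j : j' ≤ j := by omega
      have hTm : T ∈ Icc (CascadeParams.tStart j') (CascadeParams.tStart (j' + 1)) := by
        rw [hTJ, hj']
        exact ⟨CascadeParams.tStart_strictMono.monotone (Nat.le_succ j'), le_rfl⟩
      obtain ⟨h1, h2⟩ := hin j' (le_of_eq hj'.symm) T hTm
      exact ⟨h1.trans (envelope_mono' hBz0 hν0.le hRZ1 hj'j), h2.trans (envelope_mono' hB₂0 hν0.le hRV1 hj'j)⟩

end Summit.AnomalousDissipation.AnomalousDissipation.Theorems.SawtoothPulseCascade.LipAgmon
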